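import Literature.Geometry.Lorentzian.CarterSuperradiantCorePoly
import Literature.Geometry.Lorentzian.TeukolskyKernelRegimeReduction
import Summits.FinalStateConjecture.FinalStateConjecture.Theorems.PhaseMixingCaptureKappaExplicitWaveDecayFullConeCensus
import HarnessLib

/-!
# The BF-stable large-Λ cone kernel bound in the superradiant sector, Λ-polynomial constants
# (stub `stub_coneKernelLargeStableSuperradiantPoly` of the line `olver-dunster-uniform-reduction`)

Crux `PhaseMixingCapture.KappaExplicitWaveDecay` (stmt-FinalStateConjecture-10654), line
`olver-dunster-uniform-reduction`, stub `stub_coneKernelLargeStableSuperradiantPoly` (T2sB, skeleton v9.2):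
for `M > 0`, `θ > 0`, `ξ₁ > 0`, `θ₁ > 0` there are `Λ₀`, `a₁ < M`, `ε₀ > 0`, `C > 0`, `N` such that the
Green-kernel product of the horizon- and infinity-normalised radial Teukolsky (`s = 0`) solutions obeys

  `√(r² + a²)‖R_𝓗(r)‖ · √(r′² + a²)‖R_𝓘(r′)‖ ≤ C·Λ^N·κ^{−N}·‖𝔚(r)‖`,
  `r₊ < r ≤ r′`, `r′ ≥ r₊ + θ(r₊ − r₋)`,

for every sub-extremal `a₁ ≤ |a| < M`, admissible `(ω, m, Λ)` with `m ≠ 0`, `Λ > Λ₀`, in the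
Breitenlohner–Freedman stable sector with margin `(1 + θ₁)(2r₊ω)² ≤ Λ − 2amω`, in the cone
`|ω − mω₊| ≤ ε₀|m|`, in the SUPERRADIANT regime `ω(ω − mω₊) ≤ 0` and off the threshold layer
`2ξ₁κ ≤ |ω − mω₊|`.

Proof: the `u`-language core with Λ-polynomial constants (`Kerr.superradiantRegime_corePoly`,
`Literature/Geometry/Lorentzian/CarterSuperradiantCorePoly.lean`: deep-barrier tunnelling bound
`Literature.Analysis.ODE.kernel_le_of_deep_barrier` with the sharp Sonin cap envelope, the κ-free far
envelope, and depth + all rates of the barrier basis from the κ-free good zone) is glued by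
`Kerr.Costa2019.kernelBound_of_tortoise_core_regime` with the `(ω, m) ↦ (−ω, −m)`-invariant regime
`P a ω m Λ := Λ₀ < Λ ∧ (1 + θ₁)(2r₊ω)² ≤ Λ − 2amω ∧ ω(ω − mω₊) ≤ 0 ∧ 2ξ₁κ ≤ |ω − mω₊|`, the census being
the landed `stub_fullConeCensus`.
-/

set_option linter.dupNamespace false

noncomputable section

namespace Summit.FinalStateConjecture.FinalStateConjecture.Theorems.KappaExplicitWaveDecay.OlverDunsterUniformReduction

open Literature.Geometry.Lorentzian Literature.Analysis.ODE
open MeasureTheory Filter Set Complex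
open scoped Topology ComplexConjugate

set_option maxHeartbeats 400000 in
-- the glue of the long core through the regime reduction; many binders
/-- **T2sB · `stub_coneKernelLargeStableSuperradiantPoly`** — the BF-stable large-Λ cone kernel bound in
the superradiant sector `ω(ω − mω₊) ≤ 0`, `2ξ₁κ ≤ |ω − mω₊|`, with Λ-polynomial constants (registered
signature, skeleton v9.2). Superradiant core glued by the regime reduction with the landed census. -/
theorem stub_coneKernelLargeStableSuperradiantPoly :
    (∀ M : ℝ, 0 < M → ∀ θ : ℝ, 0 < θ → ∀ ξ₁ : ℝ, 0 < ξ₁ → ∀ θ₁ : ℝ, 0 < θ₁ →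
      ∃ (Λ₀ a₁ ε₀ C : ℝ) (N : ℕ), a₁ < M ∧ 0 < ε₀ ∧ 0 < C ∧
      ∀ a : ℝ, a₁ ≤ |a| → Kerr.IsSubextremal M a →
        ∀ (ω : ℝ) (m : ℤ) (Λ : ℝ), Kerr.IsAdmissibleTriple a ω m Λ → m ≠ 0 → Λ₀ < Λ →
          (1 + θ₁) * (2 * Kerr.rPlus M a * ω) ^ 2 ≤ Λ - 2 * a * m * ω →
          |ω - m * Kerr.horizonAngularVelocity M a| ≤ ε₀ * |(m : ℝ)| →
          ω * (ω - m * Kerr.horizonAngularVelocity M a) ≤ 0 →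
          2 * ξ₁ * Kerr.surfaceGravity M a ≤ |ω - m * Kerr.horizonAngularVelocity M a| →
            ∀ RH RI : ℝ → ℂ,
              Kerr.IsRadialTeukolskySolution M a 0 ω m (Λ - a ^ 2 * ω ^ 2) RH →
              Kerr.IsNormalisedHorizonSolution M a 0 ω m RH →
              Kerr.IsRadialTeukolskySolution M a 0 ω m (Λ - a ^ 2 * ω ^ 2) RI →
              Kerr.IsNormalisedInfinitySolution M 0 ω RI →
                ∀ r r' : ℝ, Kerr.rPlus M a < r → r ≤ r' →
                  Kerr.rPlus M a + θ * (Kerr.rPlus M a - Kerr.rMinus M a) ≤ r' →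
                    Real.sqrt (r ^ 2 + a ^ 2) * ‖RH r‖ * (Real.sqrt (r' ^ 2 + a ^ 2) * ‖RI r'‖) ≤
                      C * Λ ^ N * (Kerr.surfaceGravity M a)⁻¹ ^ N * ‖Kerr.radialWronskian M a 0 RH RI r‖) := by
  intro M hM θ hθ ξ₁ hξ₁ θ₁ hθ₁
  -- the core
  obtain ⟨Λ₀, a₁, ε₀, C, N, ha₁, hε₀, hC, hcoreS⟩ :=
    Kerr.superradiantRegime_corePoly stub_fullConeCensus hM hθ hξ₁ hθ₁
  -- the regime
  set P : ℝ → ℝ → ℤ → ℝ → Prop := fun a ω m Λ ↦ Λ₀ < Λ ∧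
    (1 + θ₁) * (2 * Kerr.rPlus M a * ω) ^ 2 ≤ Λ - 2 * a * m * ω ∧
    ω * (ω - m * Kerr.horizonAngularVelocity M a) ≤ 0 ∧
    2 * ξ₁ * Kerr.surfaceGravity M a ≤ |ω - m * Kerr.horizonAngularVelocity M a| with hPdef
  have hP : ∀ a ω m Λ, P a ω m Λ → P a (-ω) (-m) Λ := by
    intro a ω m Λ ⟨h1, h2, h3, h4⟩
    have e : -ω - ((-m : ℤ) : ℝ) * Kerr.horizonAngularVelocity M a =
        -(ω - m * Kerr.horizonAngularVelocity M a) := by push_cast; ring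
    refine ⟨h1, ?_, ?_, ?_⟩
    · have e1 : (2 * Kerr.rPlus M a * -ω) ^ 2 = (2 * Kerr.rPlus M a * ω) ^ 2 := by ring
      have e2 : Λ - 2 * a * ((-m : ℤ) : ℝ) * -ω = Λ - 2 * a * m * ω := by push_cast; ring
      rw [e1, e2]; exact h2
    · rw [e]
      have e3 : -ω * -(ω - m * Kerr.horizonAngularVelocity M a) =
          ω * (ω - m * Kerr.horizonAngularVelocity M a) := by ring
      rw [e3]; exact h3
    · rw [e, abs_neg]; exact h4
  -- the core for `0 < m` in the format of the regime reduction
  have hcore : ∀ a : ℝ, a₁ ≤ |a| → Kerr.IsSubextremal M a →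
      ∀ (ω : ℝ) (m : ℤ) (Λ : ℝ), Kerr.IsAdmissibleTriple a ω m Λ → 0 < m →
        |ω - m * Kerr.horizonAngularVelocity M a| ≤ ε₀ * |(m : ℝ)| → P a ω m Λ →
          ∀ ρ : ℝ → ℝ, Kerr.IsTortoiseRadius M a ρ →
          ∀ uH uH₁ uI uI₁ : ℝ → ℂ,
            (∀ x, HasDerivAt uH (uH₁ x) x ∧
              HasDerivAt uH₁ (-(((ω ^ 2 - Kerr.sepPotential M a ω m Λ (ρ x) : ℝ) : ℂ) * uH x)) x) →
            (∀ x, HasDerivAt uI (uI₁ x) x ∧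
              HasDerivAt uI₁ (-(((ω ^ 2 - Kerr.sepPotential M a ω m Λ (ρ x) : ℝ) : ℂ) * uI x)) x) →
            Tendsto (fun x ↦ ‖uH x‖) atBot (𝓝 1) →
            Tendsto (fun x ↦ ‖uH₁ x‖) atBot (𝓝 |ω - m * Kerr.horizonAngularVelocity M a|) →
            (∀ x, (starRingEnd ℂ (uH x) * uH₁ x).im = -(ω - m * Kerr.horizonAngularVelocity M a)) →
            Tendsto (fun x ↦ ‖uI x‖) atTop (𝓝 1) →
            Tendsto (fun x ↦ ‖uI₁ x‖) atTop (𝓝 |ω|) →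
            (∀ x, (starRingEnd ℂ (uI x) * uI₁ x).im = ω) →
              ∀ x x' : ℝ, x ≤ x' → Kerr.rPlus M a + θ * (Kerr.rPlus M a - Kerr.rMinus M a) ≤ ρ x' →
                ‖uH x‖ * ‖uI x'‖ ≤
                  C * Λ ^ N * (Kerr.surfaceGravity M a)⁻¹ ^ N * ‖uH x * uI₁ x - uI x * uH₁ x‖ := by
    intro a ha hsub ω m Λ hadm hm hcone hPw ρ hρ uH uH₁ uI uI₁ hu hv hH0 hH1 hHf hI0 hI1 hIf x x' hxx' hx'
    obtain ⟨hΛ, hBF, hωσ, hfl⟩ := hPw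
    exact hcoreS a ha hsub ω m Λ hadm hm hΛ hBF hcone hωσ hfl ρ hρ uH uH₁ uI uI₁ hu hv hH0 hH1 hHf hI0 hI1
      hIf x x' hxx' hx'
  -- the regime reduction
  obtain ⟨a₂, ε₂, ha₂, hε₂, -, -, hred⟩ := Kerr.Costa2019.kernelBound_of_tortoise_core_regime hM
    ha₁ hε₀ P hP hcore
  refine ⟨Λ₀, a₂, ε₂, C, N, ha₂, hε₂, hC, ?_⟩
  intro a ha hsub ω m Λ hadm hm hΛ hBF hcone hωσ hfl RH RI hH hnH hI hnI r r' hr hrr' hr'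
  exact hred a ha hsub ω m Λ hadm hm hcone ⟨hΛ, hBF, hωσ, hfl⟩ RH RI hH hnH hI hnI r r' hr hrr' hr'

end Summit.FinalStateConjecture.FinalStateConjecture.Theorems.KappaExplicitWaveDecay.OlverDunsterUniformReduction

end
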